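import Literature.IUT.HodgeArakelov.ThetaEvaluationSettingModelOfProp15
import Literature.IUT.HodgeArakelov.EtaleThetaDataOfSettingInversionOverGK

/-!
# [IUTchII] Prop 2.2 (ii)′ at the MODEL — the μ_{2l}-clause closer on the [EtTh] §1 NAMED-FACT route with the
# ι-datum reductions composed in (node IUTchII:Prop2.2(ii); GAP row G-w4d010-2, dispositions D-G-w4d010-2g and D-G-w4d010-2h)

S. Mochizuki, *Inter-universal Teichmüller theory II*, kurims manuscript (Dec. 2020) §2, Prop. 2.2 (ii) p. 66 l. 55–61
(«the condition of invariance with respect to `ι` … determines a specific `μ_{2l}`- (respectively, `μ (= M^μ_TM(Π_v))`-) orbit»;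
claim key `Mochizuki2012`, DISPUTED, D-0012), Rmk. 1.4.1 (ii) p. 28, Rmk. 2.1.1 (i) p. 65; S. Mochizuki, *The étale theta function …* [EtTh],
Publ. RIMS **45** (2009) (refereed): §2 p. 36 («multiplication by `−1` on the underlying elliptic curve»), Prop. 2.2 (i)
p. 37, Prop. 1.5 (ii), (iii) PRIMS-render PDF p. 23, Def. 2.7 p. 41; [AbsAnab] Lem. 1.3.8 (FACT-LIST F-0007
`FundamentalExtension.PreservesGeom`).

PROOF-ONLY companion (cell abc-iut, D-0067 wave 4, seat abc-iut-w4-d010 gen 3 — the node's END-TO-END assembler lineage;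
NO definitions, NO `Prop`-valued facts, nothing landed is edited). It COMPOSES, by name only, the two half-reductions of
the μ_{2l}-clause of [IUTchII] Prop. 2.2 (ii) at the model `D := etaleThetaDataOfSetting'` that landed separately:
* abc-iut-L2-t8's discharge of the class-level (R2)/(R3) binders from the [EtTh] §1 NAMED FACTS
  (`h14sign_of_prop15iii` ⟸ F-0591 `Prop15iii`; `h14free_of_prop15` ⟸ F-0591 + F-2503 `Prop15ii` + the printed clause
  `hL` (G-L2t1-1) + F-2498 `IsEtThOrigin`; `ThetaEvaluationSettingModelOfProp15.lean`, p419369), and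
* abc-iut-w5-d072 / abc-iut-w4-d014's reductions of the (R1) ι-datum: the theta companion CONSTRUCTED
  (`ThetaSetting.thetaCompanionOfAut ι hΔ hq`, p416913), `hZ` («ι reverses `Z`») ⟸ (R1e′) `hinv`
  (`toZ_inversion_generator_of_inversion`, p420219), `hβ` («`ι^Θ ≡ +1` on `Δ̄_Θ`») ⟸ `hinv`
  (`prop22_ii'_model_of_inversion_of_classLevel_of_ab`, p419591), `hΔ` («`ι(Δ^tp_X) = Δ^tp_X`») ⟸ «ι over `G_K`» or
  ⟸ F-0007 (`Sec1AutPreservesDeltaTemp`, p420905),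
over this lineage's class-level assembly `prop22_ii'_model_of_inversion_of_classLevel` (p417690) and generator lemma
`exists_translation_generators` (p412797; the `toLZ`-generator `γ` is no longer a binder).

RESULT. `prop22_ii'_model_of_hinv_of_prop15` / `…_of_hinv_over_of_prop15` / `…_of_hinv_of_preservesGeom_of_prop15`:
`Prop22_ii' Dec` for EVERY Prop. 2.2 (i) datum `Dec` over the model, GIVEN EXACTLY — the model inputs (`C`, `hC`, `hS`,
(H1) `hchar`, `S`, `eS`, `hl`); the ι-DATUM «a topological automorphism `ι` of `Π^tp_X` with `ι(Π^tp_X̲̲) = Π^tp_X̲̲` (`hι`),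
`ι(Δ^tp_X) = Δ^tp_X` (`hΔ`; resp. `ι` over `G_K` up to `Inn`, resp. the F-0007 instance), `ι² = conj δ` on `Π^tp_X̲̲`
(`hιι`), `ι̂ ≡ −1` on `Δ_X^ab` (`hinv`)» and the root-topology input `hq : IsQuotientMap toTheta`; ONE deck element `ε`
with the ONE class-level statement `h14iota` («`Θ̈(Ü) = −Θ̈(Ü⁻¹)`» at the `Δ_Θ`-class level, [EtTh] Prop. 1.4 (ii));
and the NAMED FACTS F-2498, F-0591, F-2503 (+ `hL`). No theta-companion datum, no `hZ`/`hβ`/`γ` binder and no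
`ThetaKummerInput` package remain on this route.
Honest framing: every input about `ι`, `hq`, `h14iota` and every [EtTh] named fact stays a hypothesis; F-0007 enters as a
named hypothesis at an instance; nothing here bears on [IUTchIII] Cor. 3.12. [claim: Mochizuki2012, status: disputed]
typed ≠ proved.
-/

namespace Literature.IUT.HodgeArakelov

open Literature.AnabelianGeometry.EtaleTheta (ContH1 ThetaSetting)
open Literature.AnabelianGeometry.EtaleTheta Literature.AnabelianGeometry.AbsoluteAnabelian
open Literature.AnabelianGeometry.SemiGraphs (GQp)
open EtaleThetaDataOfSetting CohomologySystemOfContH1 Topology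
open scoped commutatorElement

noncomputable section

namespace EtaleThetaDataOfSetting

variable {p : ℕ} [Fact p.Prime] {D : Literature.AnabelianGeometry.EtaleTheta.ThetaSetting p}
  {E : D.EtaleThetaData} {l : ℕ} (C : E.DoubleUnderline l)

section Inversion

variable (ι : D.PiTemp ≃ₜ* D.PiTemp) (hι : C.Huu.map ι.toMulEquiv.toMonoidHom = C.Huu)
  (hinv : ∀ g ∈ D.toTemperedCurve.DeltaHat, D.toTemperedCurve.completionAut ι g * g ∈
    (⁅D.toTemperedCurve.DeltaHat, D.toTemperedCurve.DeltaHat⁆).topologicalClosure)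

include hinv in
/-- **IUTchII:Prop2.2(ii)′ at the model on the [EtTh] §1 NAMED-FACT route, ι-datum reduced** (kurims p. 66): for a
topological automorphism `ι` of `Π^tp_X` with `ι(Π^tp_X̲̲) = Π^tp_X̲̲` (`hι`), `ι(Δ^tp_X) = Δ^tp_X` (`hΔ`), `ι² = conj δ` on
`Π^tp_X̲̲` (`hιι`) and `ι̂ ≡ −1` on `Δ_X^ab` (`hinv`), the root-topology input `hq`, a deck element `ε ∈ Π^tp_Y ∖ Π^tp_Ÿ` with
the class-level `ι`-statement `h14iota` at the CONSTRUCTED theta companion `thetaCompanionOfAut ι hΔ hq`, and the named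
facts `IsEtThOrigin` (F-2498), `Prop15iii` (F-0591), `Prop15ii` (F-2503) with the printed clause `hL`: `Prop22_ii' Dec`.
The binders `c`, `hZ`, `hβ`, `γ`, `h14sign`, `h14free` of the landed closers are all supplied by name.
[claim: Mochizuki2012, status: disputed] (IUTchII §2 Prop 2.2 (ii), kurims pp.65-67) -/
theorem prop22_ii'_model_of_hinv_of_prop15 (hΔ : D.DeltaTemp.map ι.toMulEquiv.toMonoidHom = D.DeltaTemp)
    (hq : IsQuotientMap D.toTheta)
    [hN : (PiYdd C).Normal] [hYN : D.GtpYdd.Normal] (hC : D.Compat) (hS : D.Sec2Hyps)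
    (hchar : PiYddCharacteristic C) (S : BadPlaceSetting.{0}) (eS : (Pi C) ≃ₜ* S.PiX) (hl : S.l = l)
    {T₀ : TemperedCoverings S (Pi C)}
    (Dec : SubgraphDecomposition S T₀ (etaleThetaDataOfSetting' C hC hS hchar S.toThetaSetting eS hl))
    -- the deck element and `ι² = conj δ`
    (ε : Pi C) (hε₁ : (ε : D.PiTemp) ∈ D.GtpY) (hε₂ : (ε : D.PiTemp) ∉ D.GtpYdd)
    (δ : Pi C) (hιι : ∀ x : Pi C, ι (ι (x : D.PiTemp)) = (δ : D.PiTemp) * (x : D.PiTemp) * (δ : D.PiTemp)⁻¹)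
    -- (R2) the class-level ι-statement ("Θ̈(Ü) = −Θ̈(Ü⁻¹)") at the constructed theta companion
    (h14iota : ContH1Aut.autMap (phi C) D.DeltaTheta (inversionAlpha C ι hι) (D.thetaCompanionOfAut ι hΔ hq).thetaIso
        (thetaCompanion_phi C ι hι (D.thetaCompanionOfAut ι hΔ hq))
        (thetaCompanion_mem_deltaTheta ι (D.thetaCompanionOfAut ι hΔ hq))
        (symm_mem_inf_top (PiYdd C) (inversionAlpha C ι hι) (mem_PiYdd_iff_of_piYddCharacteristic C hchar _))
        (ContH1.comap D.toTheta D.DeltaTheta C.Huu.subtype continuous_subtype_val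
          (map_subtype_piYdd_inf_le_GtpYdd C ⊤) E.etaDd) =
      ContH1.conj (phi C) D.DeltaTheta ε
        (ContH1.comap D.toTheta D.DeltaTheta C.Huu.subtype continuous_subtype_val
          (map_subtype_piYdd_inf_le_GtpYdd C ⊤) E.etaDd))
    -- the [EtTh] §1 named facts
    (hO : D.IsEtThOrigin) (h15 : ThetaSetting.Prop15iii E hC) (h15ii : ThetaSetting.Prop15ii E.toKummerData hC)
    (hL : ∀ n : ℤ, E.logUdd ^ n ∈
      (ThetaSetting.Fdd2 : Subgroup (D.H1Theta (D.GtpYdd.map D.toTheta))) → n = 0) :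
    Prop22_ii' Dec := by
  -- a `toLZ`-generator `γ` of `Π^tp_X̲̲/Π^tp_Y̲̲ ≅ ℤ` exists (this lineage's `exists_translation_generators`)
  obtain ⟨γ, -, hγ, -, -⟩ := exists_translation_generators C hS
  exact prop22_ii'_model_of_inversion_of_classLevel_of_ab C ι hι (D.thetaCompanionOfAut ι hΔ hq) hC hS hchar S eS
    hl Dec γ ε hγ hε₁ hε₂ (toZ_inversion_generator_of_inversion C ι hι hinv hS hchar γ hγ) δ hιι hinv
    (h14sign_of_prop15iii C hC hS h15 ε hε₁) h14iota (h14free_of_prop15 C hC hO h15 h15ii hL γ hγ)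

include hinv in
/-- **IUTchII:Prop2.2(ii)′ at the model on the NAMED-FACT route, for `ι` OVER `G_K`** (kurims p. 66; [IUTchII]
Rmk. 1.4.1 (ii) «over `G_k`»): as `prop22_ii'_model_of_hinv_of_prop15` with `hΔ : ι(Δ^tp_X) = Δ^tp_X` DISCHARGED from
«`aug (ι x) = a·aug(x)·a⁻¹`» (abc-iut-w4-d014's `ThetaSetting.map_deltaTemp_eq_of_aug_conj`). Residual binders on this
route: model inputs; the ι-datum {`ι`, `hι`, `a`/`haug`, `hq`, `δ`/`hιι`, `hinv`}; `ε` with `h14iota`; the named facts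
F-2498 / F-0591 / F-2503 (+ `hL`). [claim: Mochizuki2012, status: disputed] (IUTchII §2 Prop 2.2 (ii), kurims pp.65-67) -/
theorem prop22_ii'_model_of_hinv_over_of_prop15 (a : GQp p) (haug : ∀ x : D.PiTemp, D.aug (ι x) = a * D.aug x * a⁻¹)
    (hq : IsQuotientMap D.toTheta)
    [hN : (PiYdd C).Normal] [hYN : D.GtpYdd.Normal] (hC : D.Compat) (hS : D.Sec2Hyps)
    (hchar : PiYddCharacteristic C) (S : BadPlaceSetting.{0}) (eS : (Pi C) ≃ₜ* S.PiX) (hl : S.l = l)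
    {T₀ : TemperedCoverings S (Pi C)}
    (Dec : SubgraphDecomposition S T₀ (etaleThetaDataOfSetting' C hC hS hchar S.toThetaSetting eS hl))
    (ε : Pi C) (hε₁ : (ε : D.PiTemp) ∈ D.GtpY) (hε₂ : (ε : D.PiTemp) ∉ D.GtpYdd)
    (δ : Pi C) (hιι : ∀ x : Pi C, ι (ι (x : D.PiTemp)) = (δ : D.PiTemp) * (x : D.PiTemp) * (δ : D.PiTemp)⁻¹)
    (h14iota : ContH1Aut.autMap (phi C) D.DeltaTheta (inversionAlpha C ι hι)
        (D.thetaCompanionOfAut ι (D.map_deltaTemp_eq_of_aug_conj ι a haug) hq).thetaIso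
        (thetaCompanion_phi C ι hι (D.thetaCompanionOfAut ι (D.map_deltaTemp_eq_of_aug_conj ι a haug) hq))
        (thetaCompanion_mem_deltaTheta ι (D.thetaCompanionOfAut ι (D.map_deltaTemp_eq_of_aug_conj ι a haug) hq))
        (symm_mem_inf_top (PiYdd C) (inversionAlpha C ι hι) (mem_PiYdd_iff_of_piYddCharacteristic C hchar _))
        (ContH1.comap D.toTheta D.DeltaTheta C.Huu.subtype continuous_subtype_val
          (map_subtype_piYdd_inf_le_GtpYdd C ⊤) E.etaDd) =
      ContH1.conj (phi C) D.DeltaTheta ε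
        (ContH1.comap D.toTheta D.DeltaTheta C.Huu.subtype continuous_subtype_val
          (map_subtype_piYdd_inf_le_GtpYdd C ⊤) E.etaDd))
    (hO : D.IsEtThOrigin) (h15 : ThetaSetting.Prop15iii E hC) (h15ii : ThetaSetting.Prop15ii E.toKummerData hC)
    (hL : ∀ n : ℤ, E.logUdd ^ n ∈
      (ThetaSetting.Fdd2 : Subgroup (D.H1Theta (D.GtpYdd.map D.toTheta))) → n = 0) :
    Prop22_ii' Dec :=
  prop22_ii'_model_of_hinv_of_prop15 C ι hι hinv (D.map_deltaTemp_eq_of_aug_conj ι a haug) hq hC hS hchar S eS hl Dec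
    ε hε₁ hε₂ δ hιι h14iota hO h15 h15ii hL

include hinv in
/-- **IUTchII:Prop2.2(ii)′ at the model on the NAMED-FACT route, for an ARBITRARY topological automorphism `ι`, with
`hΔ` BY NAME from [AbsAnab] Lem. 1.3.8** (FACT-LIST F-0007 `FundamentalExtension.PreservesGeom`, bound at a fundamental
extension `(F, eF)` modelling `Π_X ↠ G_K` — abc-iut-w4-d014's `ThetaSetting.map_deltaTemp_eq_of_preservesGeom`); otherwise
as `prop22_ii'_model_of_hinv_of_prop15`. [claim: Mochizuki2012, status: disputed] (IUTchII §2 Prop 2.2 (ii), kurims pp.65-67) -/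
theorem prop22_ii'_model_of_hinv_of_preservesGeom_of_prop15 (F : FundamentalExtension.{0})
    (eF : F.arith ≃ₜ* D.PiHat) (heF : F.geom.map eF.toMulEquiv.toMonoidHom = D.DeltaHat)
    (h138 : FundamentalExtension.PreservesGeom (F := F)
      (eF.trans ((D.toTemperedCurve.completionAut ι).trans eF.symm)))
    (hq : IsQuotientMap D.toTheta)
    [hN : (PiYdd C).Normal] [hYN : D.GtpYdd.Normal] (hC : D.Compat) (hS : D.Sec2Hyps)
    (hchar : PiYddCharacteristic C) (S : BadPlaceSetting.{0}) (eS : (Pi C) ≃ₜ* S.PiX) (hl : S.l = l)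
    {T₀ : TemperedCoverings S (Pi C)}
    (Dec : SubgraphDecomposition S T₀ (etaleThetaDataOfSetting' C hC hS hchar S.toThetaSetting eS hl))
    (ε : Pi C) (hε₁ : (ε : D.PiTemp) ∈ D.GtpY) (hε₂ : (ε : D.PiTemp) ∉ D.GtpYdd)
    (δ : Pi C) (hιι : ∀ x : Pi C, ι (ι (x : D.PiTemp)) = (δ : D.PiTemp) * (x : D.PiTemp) * (δ : D.PiTemp)⁻¹)
    (h14iota : ContH1Aut.autMap (phi C) D.DeltaTheta (inversionAlpha C ι hι)
        (D.thetaCompanionOfAut ι (D.map_deltaTemp_eq_of_preservesGeom ι F eF heF h138) hq).thetaIso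
        (thetaCompanion_phi C ι hι (D.thetaCompanionOfAut ι (D.map_deltaTemp_eq_of_preservesGeom ι F eF heF h138) hq))
        (thetaCompanion_mem_deltaTheta ι
          (D.thetaCompanionOfAut ι (D.map_deltaTemp_eq_of_preservesGeom ι F eF heF h138) hq))
        (symm_mem_inf_top (PiYdd C) (inversionAlpha C ι hι) (mem_PiYdd_iff_of_piYddCharacteristic C hchar _))
        (ContH1.comap D.toTheta D.DeltaTheta C.Huu.subtype continuous_subtype_val
          (map_subtype_piYdd_inf_le_GtpYdd C ⊤) E.etaDd) =
      ContH1.conj (phi C) D.DeltaTheta ε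
        (ContH1.comap D.toTheta D.DeltaTheta C.Huu.subtype continuous_subtype_val
          (map_subtype_piYdd_inf_le_GtpYdd C ⊤) E.etaDd))
    (hO : D.IsEtThOrigin) (h15 : ThetaSetting.Prop15iii E hC) (h15ii : ThetaSetting.Prop15ii E.toKummerData hC)
    (hL : ∀ n : ℤ, E.logUdd ^ n ∈
      (ThetaSetting.Fdd2 : Subgroup (D.H1Theta (D.GtpYdd.map D.toTheta))) → n = 0) :
    Prop22_ii' Dec :=
  prop22_ii'_model_of_hinv_of_prop15 C ι hι hinv (D.map_deltaTemp_eq_of_preservesGeom ι F eF heF h138) hq hC hS hchar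
    S eS hl Dec ε hε₁ hε₂ δ hιι h14iota hO h15 h15ii hL

end Inversion

end EtaleThetaDataOfSetting

end

end Literature.IUT.HodgeArakelov
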